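import Literature.Topology.FourManifolds.HCobordismSecondCancellationLeaves
import Literature.Topology.FourManifolds.HCobordismWhitneyIsotopyProofs
import HarnessLib

/-!
# Milnor 1965, Thm. 6.4 / Cor. 6.5 on a slab and the Whitney procedure on the level: discharge
# of `Cobordism.Milnor1965_secondCancellation_slab` and `Cobordism.Milnor1965_whitneyTrick_isotopy`

Topic `Literature/Topology/FourManifolds`; written by the fact seat
`provefact-Literature.Topology.FourManifolds.Milnor1965_exists_isMorseFunction_forall_not_isMCriticalPt`
(Milnor, *Lectures on the h-cobordism theorem* (1965), Thm. 7.8), on whose reduction chain both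
facts sit (`HCobordismTheoremProofs.lean`:
`Milnor1965_exists_isMorseFunction_forall_not_isMCriticalPt_of_isolatedPair_of_secondCancellation`).
`HCobordismSecondCancellationLeaves.lean` reduces both named facts to Thm. 6.6 with its Remark
(`Literature.Topology.FourManifolds.Milnor1965_whitney_isotopy`) alone —
`Cobordism.Milnor1965_whitneyTrick_isotopy_of_whitney_isotopy`,
`Cobordism.Milnor1965_secondCancellation_slab_of_whitney_isotopy` (Milnor, proof of Thm. 6.4,
PDF p. 39 of the held copy `lit read book:milnornd-lectures-h-cobordism-theorem`: Thm. 5.2,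
Remark 1, Cor. 7.3 on the slab, the case `λ = 2`, the turning about of Cor. 6.5 and the
induction on the number of intersection points being theorems of the tree) — and Thm. 6.6 is now
proved (`Literature.Topology.FourManifolds.Milnor1965_whitney_isotopy_holds`,
`HCobordismWhitneyIsotopyProofs.lean`).  This file records the two discharges:

* `Cobordism.Milnor1965_whitneyTrick_isotopy_holds`;
* `Cobordism.Milnor1965_secondCancellation_slab_holds`.

Everything here is proved; no definitions, no named facts.

## References

* J. Milnor, *Lectures on the h-cobordism theorem*, notes by L. Siebenmann and J. Sondow,
  Princeton Mathematical Notes (1965): Thm. 6.4, Remarks, Cor. 6.5, Thm. 6.6 and Remark, proof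
  of Thm. 6.4 (PDF pp. 37–39), Cor. 7.3 (PDF p. 47).  Held:
  `lit read book:milnornd-lectures-h-cobordism-theorem`. [MilnorHCobordism1965]
-/

noncomputable section

namespace Literature.Topology.FourManifolds

universe u

/-- **Milnor 1965, one round of the Whitney procedure on the level
(`Literature.Topology.FourManifolds.Cobordism.Milnor1965_whitneyTrick_isotopy`), proved**: Thm.
6.6 with its Remark is a theorem of the tree
(`Literature.Topology.FourManifolds.Milnor1965_whitney_isotopy_holds`), and the fact followed
from it alone (`Cobordism.Milnor1965_whitneyTrick_isotopy_of_whitney_isotopy`: Cor. 7.3 on the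
slab and the case `λ = 2` being theorems). [cite: MilnorHCobordism1965, proof of Thm. 6.4 (PDF p. 39), Thm. 6.6 and Remark (PDF pp. 38–39), Cor. 7.3 (PDF p. 47)] -/
theorem Cobordism.Milnor1965_whitneyTrick_isotopy_holds :
    Cobordism.Milnor1965_whitneyTrick_isotopy.{u} :=
  Cobordism.Milnor1965_whitneyTrick_isotopy_of_whitney_isotopy Milnor1965_whitney_isotopy_holds

/-- **Milnor 1965, Thm. 6.4 / Cor. 6.5 on a slab
(`Literature.Topology.FourManifolds.Cobordism.Milnor1965_secondCancellation_slab`), proved**: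
from Thm. 6.6 (`Milnor1965_whitney_isotopy_holds`) through
`Cobordism.Milnor1965_secondCancellation_slab_of_whitney_isotopy` (Thm. 5.2 with Lemma 5.3 and
Lemma 4.7, Remark 1 after Thm. 6.4, Cor. 7.3 on the slab, the case `λ = 2`, the turning about
of Cor. 6.5, the inversion of the isotopy and the induction on the number of intersection
points are theorems of the tree). [cite: MilnorHCobordism1965, Thm. 6.4, Cor. 6.5 and the proof of Thm. 6.4 (PDF pp. 37–39), Thm. 6.6 and Remark (PDF pp. 38–39)] -/
theorem Cobordism.Milnor1965_secondCancellation_slab_holds :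
    Cobordism.Milnor1965_secondCancellation_slab.{u} :=
  Cobordism.Milnor1965_secondCancellation_slab_of_whitney_isotopy Milnor1965_whitney_isotopy_holds

end Literature.Topology.FourManifolds

end
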